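import Summits.QuantumFields.YangMills.Theorems.LuscherReductionRunningReductionLatticeLinkKernel
import Summits.QuantumFields.YangMills.Theorems.LuscherReductionRunningReductionConstLift
import Mathlib.Analysis.InnerProductSpace.Basic
import HarnessLib

/-!
# The electric kernel of `SU(2)` on `(ℤ/L)³` is an EXACT Gaussian in the Frobenius-linear link coordinates, and factorises EXACTLY into a
# zero-mode (direction-mean) Gaussian at the one-site coupling `L³β` and a fluctuation Gaussian
# (lane B «VARIATIONAL LOWER» of S-BASE, crux `TwistedTraceScaling` stmt-QuantumFields-20203; Born–Oppenheimer seam for both COARSE lanes)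

The transfer kernel of the tree is `K_β = latE · e^{−(β/2)(S(U)+S(V))}` (`transferKernel_eq_latE_mul`) with the electric (kinetic) factor
`latE L β U V = ∏ₑ w_β(UₑVₑ⁻¹)`, `w_β(W) = e^{β Re tr W}`.  Since `Re tr(UV⁻¹) = 2 − ½‖U − V‖_F²` on `SU(2)` (`two_sub_re_trace_eq`,
`frobNorm_sub_eq_mul_inv`), the electric factor is, with NO approximation,

  `latE L β U V = e^{2β|E|} · exp(−(β/2) Σₑ ‖Uₑ − Vₑ‖_F²)`                                   (`latE_eq_exp_frobSq`)

— the harmonic-transfer-kernel kinetic Gaussian `e^{−b‖x−y‖²}` of `Literature.…GaussianTransferKernel(Frame)` with `b = β/2`, restricted from the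
linear space `(M₂(ℂ))^E` to the product of spheres `SU(2)^E`.  Splitting every link matrix into its DIRECTION MEAN
`meanLink k U = |sites|⁻¹ Σ_x U_{(x,k)}` (a `2×2` matrix in the real span of `SU(2)`, not a group element) and its FLUCTUATION
`flucLink (x,k) U = U_{(x,k)} − meanLink k U` (mean zero in `x`), Pythagoras in the Frobenius inner product gives, again exactly,

  `Σₑ ‖Uₑ − Vₑ‖_F² = |sites| · Σ_k ‖m_k(U) − m_k(V)‖_F² + Σₑ ‖fₑ(U) − fₑ(V)‖_F²`                  (`sum_frobSq_eq_mean_add_fluc`)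
  `latE L β U V = e^{2β|E|} · exp(−(β|sites|/2) Σ_k ‖m_k(U) − m_k(V)‖_F²) · exp(−(β/2) Σₑ ‖fₑ(U) − fₑ(V)‖_F²)`   (`latE_eq_mean_mul_fluc`):

the zero-mode factor is the one-site electric Gaussian at the ONE-SITE COUPLING `B' = |sites|·β = L³β` (cf. `transferKernel_constLift`: on
constant configurations `m_k = U_k`, `fₑ = 0` — `meanLink_constLift`, `flucLink_constLift`), the second factor is the kinetic Gaussian of the
stiff modes.  This is the exact Born–Oppenheimer seam of the KINETIC term; the magnetic factor `e^{−(β/2)S}` is where the semiclassics lives.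
HONEST FRAMING: finite-dimensional algebra; no estimate; femto rung R2b1 (stub of a child of a CONDITIONAL route); not a gap, not Clay.
-/

set_option autoImplicit false

noncomputable section

open MeasureTheory Filter Topology Real
open scoped Matrix ComplexConjugate BigOperators RealInnerProductSpace
open Literature.MathematicalPhysics.QuantumFieldTheory
open Literature.MathematicalPhysics.QuantumLattice

namespace Summit.QuantumFields.YangMills.Theorems.FemtoTransferGap.TwoLattice.Electric

open Summit.QuantumFields.YangMills.Theorems.FemtoTransferGap

variable {L : ℕ} [NeZero L]

/-! ## §1 One link: `w_β(uv⁻¹) = e^{2β} e^{−(β/2)‖u − v‖_F²}` -/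

/-- `frobNorm A² = Σᵢⱼ ‖Aᵢⱼ‖²`. [cite: HornJohnson2013, (0.2.5)] -/
theorem frobNorm_sq_eq_sum {n : Type*} [Fintype n] (A : Matrix n n ℂ) : frobNorm A ^ 2 = ∑ i, ∑ j, ‖A i j‖ ^ 2 := by
  unfold frobNorm
  rw [Real.sq_sqrt (Finset.sum_nonneg fun i _ => Finset.sum_nonneg fun j _ => sq_nonneg _)]

/-- **One-link electric weight as an exact Gaussian**: `w_β(uv⁻¹) = e^{2β} · e^{−(β/2)‖u − v‖_F²}` on `SU(2)`. [cite: MontvayMunster1994, §3.2.3 (3.97)] -/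
theorem linkW_eq_exp_frobSq (β : ℝ) (u v : SU2) :
    linkW β (u * v⁻¹) =
      Real.exp (2 * β) * Real.exp (-(β / 2 * frobNorm ((u : Matrix (Fin 2) (Fin 2) ℂ) - (v : Matrix (Fin 2) (Fin 2) ℂ)) ^ 2)) := by
  unfold linkW
  rw [← Real.exp_add]
  congr 1
  have h := two_sub_re_trace_eq (u * v⁻¹)
  rw [← frobNorm_sub_eq_mul_inv] at h
  have h' : (((u * v⁻¹ : SU2) : Matrix (Fin 2) (Fin 2) ℂ).trace).re =
      2 - frobNorm ((u : Matrix (Fin 2) (Fin 2) ℂ) - (v : Matrix (Fin 2) (Fin 2) ℂ)) ^ 2 / 2 := by linarith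
  rw [h']; ring

/-- ★ **The electric kernel of the `L³` torus is an exact Gaussian in the Frobenius-linear link coordinates**:
`latE L β U V = e^{2β|E|} · exp(−(β/2) Σₑ ‖Uₑ − Vₑ‖_F²)`. [cite: MontvayMunster1994, §3.2.3 (3.97)] [cite: Wipf2021, §8.5.1 (8.54)] -/
theorem latE_eq_exp_frobSq (β : ℝ) (U V : GaugeConfig 3 L SU2) :
    latE L β U V = Real.exp (2 * β) ^ Fintype.card (Edge 3 L) *
      Real.exp (-(β / 2 * ∑ e : Edge 3 L, frobNorm ((U e : Matrix (Fin 2) (Fin 2) ℂ) - (V e : Matrix (Fin 2) (Fin 2) ℂ)) ^ 2)) := by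
  unfold latE
  simp_rw [linkW_eq_exp_frobSq]
  rw [Finset.prod_mul_distrib, Finset.prod_const, Finset.card_univ, ← Real.exp_sum, Finset.mul_sum, ← Finset.sum_neg_distrib]

/-! ## §2 Direction means and fluctuations; Pythagoras -/

/-- **Direction mean** of the link matrices: `m_k(U) = |sites|⁻¹ Σ_x U_{(x,k)}` (a `2×2` complex matrix). [cite: Luscher1983, §3] -/
def meanLink (k : Fin 3) (U : GaugeConfig 3 L SU2) : Matrix (Fin 2) (Fin 2) ℂ :=
  ((Fintype.card (Site 3 L) : ℝ)⁻¹ : ℂ) • ∑ x : Site 3 L, (U (x, k) : Matrix (Fin 2) (Fin 2) ℂ)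

/-- **Fluctuation** of a link about its direction mean: `f_{(x,k)}(U) = U_{(x,k)} − m_k(U)`. [cite: Luscher1983, §3] -/
def flucLink (e : Edge 3 L) (U : GaugeConfig 3 L SU2) : Matrix (Fin 2) (Fin 2) ℂ :=
  (U e : Matrix (Fin 2) (Fin 2) ℂ) - meanLink e.2 U

/-- `m_k(U) − m_k(V)` is the mean of the differences. [folklore] -/
theorem meanLink_sub (k : Fin 3) (U V : GaugeConfig 3 L SU2) :
    meanLink k U - meanLink k V =
      ((Fintype.card (Site 3 L) : ℝ)⁻¹ : ℂ) • ∑ x : Site 3 L, ((U (x, k) : Matrix (Fin 2) (Fin 2) ℂ) - (V (x, k) : Matrix (Fin 2) (Fin 2) ℂ)) := by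
  unfold meanLink
  rw [Finset.sum_sub_distrib, smul_sub]

/-- `f_e(U) − f_e(V) = (U_e − V_e) − (m(U) − m(V))`. [folklore] -/
theorem flucLink_sub (e : Edge 3 L) (U V : GaugeConfig 3 L SU2) :
    flucLink e U - flucLink e V = ((U e : Matrix (Fin 2) (Fin 2) ℂ) - (V e : Matrix (Fin 2) (Fin 2) ℂ)) - (meanLink e.2 U - meanLink e.2 V) := by
  unfold flucLink; abel

/-- Pythagoras for the mean in a real inner-product space: `Σᵢ ‖dᵢ‖² = N‖m‖² + Σᵢ ‖dᵢ − m‖²`, `m = N⁻¹Σᵢ dᵢ`, `N = |ι| > 0`.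
[cite: HornJohnson2013, (0.6.4)] -/
theorem sum_norm_sq_eq_card_mul_mean_add {ι E : Type*} [Fintype ι] [Nonempty ι] [NormedAddCommGroup E] [InnerProductSpace ℝ E]
    (d : ι → E) :
    ∑ i, ‖d i‖ ^ 2 = (Fintype.card ι : ℝ) * ‖(Fintype.card ι : ℝ)⁻¹ • ∑ i, d i‖ ^ 2 +
      ∑ i, ‖d i - (Fintype.card ι : ℝ)⁻¹ • ∑ j, d j‖ ^ 2 := by
  set N : ℝ := (Fintype.card ι : ℝ) with hN
  have hNpos : 0 < N := by rw [hN]; exact_mod_cast Fintype.card_pos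
  set m : E := N⁻¹ • ∑ i, d i with hm
  have hsum : ∑ i, d i = N • m := by rw [hm, smul_smul, mul_inv_cancel₀ hNpos.ne', one_smul]
  have hexp : ∀ i, ‖d i - m‖ ^ 2 = ‖d i‖ ^ 2 - 2 * ⟪d i, m⟫ + ‖m‖ ^ 2 := fun i => norm_sub_sq_real _ _
  simp_rw [hexp]
  rw [Finset.sum_add_distrib, Finset.sum_sub_distrib, Finset.sum_const, Finset.card_univ, nsmul_eq_mul, ← Finset.mul_sum,
    ← sum_inner, hsum, inner_smul_left, real_inner_self_eq_norm_sq]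
  simp only [conj_trivial]
  ring

/-- ★ **Exact zero-mode / fluctuation split of the electric exponent** in direction `k`:
`Σ_x ‖U_{(x,k)} − V_{(x,k)}‖_F² = |sites|·‖m_k(U) − m_k(V)‖_F² + Σ_x ‖f_{(x,k)}(U) − f_{(x,k)}(V)‖_F²`. [cite: Luscher1983, §3] -/
theorem sum_frobSq_eq_mean_add_fluc (k : Fin 3) (U V : GaugeConfig 3 L SU2) :
    ∑ x : Site 3 L, frobNorm ((U (x, k) : Matrix (Fin 2) (Fin 2) ℂ) - (V (x, k) : Matrix (Fin 2) (Fin 2) ℂ)) ^ 2 =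
      (Fintype.card (Site 3 L) : ℝ) * frobNorm (meanLink k U - meanLink k V) ^ 2 +
        ∑ x : Site 3 L, frobNorm (flucLink (x, k) U - flucLink (x, k) V) ^ 2 := by
  -- entrywise Pythagoras in `ℂ` viewed as a real inner-product space
  set D : Site 3 L → Matrix (Fin 2) (Fin 2) ℂ := fun x => (U (x, k) : Matrix (Fin 2) (Fin 2) ℂ) - (V (x, k) : Matrix (Fin 2) (Fin 2) ℂ) with hD
  have hM : meanLink k U - meanLink k V = ((Fintype.card (Site 3 L) : ℝ)⁻¹ : ℂ) • ∑ x, D x := meanLink_sub k U V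
  have hF : ∀ x, flucLink (x, k) U - flucLink (x, k) V = D x - (meanLink k U - meanLink k V) := fun x => flucLink_sub (x, k) U V
  simp_rw [hF, hM, frobNorm_sq_eq_sum]
  -- swap the sums: `Σ_x Σ_i Σ_j = Σ_i Σ_j Σ_x`
  rw [Finset.sum_comm]
  conv_rhs => rw [Finset.mul_sum, Finset.sum_comm]
  rw [← Finset.sum_add_distrib]
  refine Finset.sum_congr rfl fun i _ => ?_
  rw [Finset.sum_comm]
  conv_rhs => rw [Finset.mul_sum, Finset.sum_comm]
  rw [← Finset.sum_add_distrib]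
  refine Finset.sum_congr rfl fun j _ => ?_
  have h := sum_norm_sq_eq_card_mul_mean_add (ι := Site 3 L) (E := ℂ) fun x => D x i j
  have hentry : (((Fintype.card (Site 3 L) : ℝ)⁻¹ : ℂ) • ∑ x, D x) i j = (Fintype.card (Site 3 L) : ℝ)⁻¹ • ∑ x, D x i j := by
    rw [Matrix.smul_apply, Matrix.sum_apply, smul_eq_mul, Complex.real_smul]
    push_cast; ring
  simp only [Matrix.sub_apply, hentry]
  exact h

/-- The same over all links: `Σₑ ‖Uₑ − Vₑ‖_F² = |sites| Σ_k ‖m_k(U) − m_k(V)‖_F² + Σₑ ‖fₑ(U) − fₑ(V)‖_F²`. [cite: Luscher1983, §3] -/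
theorem sum_edge_frobSq_eq_mean_add_fluc (U V : GaugeConfig 3 L SU2) :
    ∑ e : Edge 3 L, frobNorm ((U e : Matrix (Fin 2) (Fin 2) ℂ) - (V e : Matrix (Fin 2) (Fin 2) ℂ)) ^ 2 =
      (Fintype.card (Site 3 L) : ℝ) * ∑ k : Fin 3, frobNorm (meanLink k U - meanLink k V) ^ 2 +
        ∑ e : Edge 3 L, frobNorm (flucLink e U - flucLink e V) ^ 2 := by
  rw [Fintype.sum_prod_type, Fintype.sum_prod_type, Finset.sum_comm, Finset.mul_sum]
  conv_rhs => rw [Finset.sum_comm (s := (Finset.univ : Finset (Site 3 L)))]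
  rw [← Finset.sum_add_distrib]
  exact Finset.sum_congr rfl fun k _ => sum_frobSq_eq_mean_add_fluc k U V

/-! ## §3 The exact factorisation of the electric kernel -/

/-- ★ **EXACT BORN–OPPENHEIMER SEAM OF THE KINETIC TERM**: the electric kernel of the `L³` torus factorises into the one-site electric
Gaussian at coupling `B' = |sites|·β` evaluated at the direction means and the kinetic Gaussian of the fluctuations:
`latE L β U V = e^{2β|E|} · exp(−(β|sites|/2) Σ_k ‖m_k(U) − m_k(V)‖_F²) · exp(−(β/2) Σₑ ‖fₑ(U) − fₑ(V)‖_F²)`.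
[cite: Luscher1983, §3] [cite: Wipf2021, §8.5.2 (8.64)–(8.67)] -/
theorem latE_eq_mean_mul_fluc (β : ℝ) (U V : GaugeConfig 3 L SU2) :
    latE L β U V = Real.exp (2 * β) ^ Fintype.card (Edge 3 L) *
      Real.exp (-(β * Fintype.card (Site 3 L) / 2 * ∑ k : Fin 3, frobNorm (meanLink k U - meanLink k V) ^ 2)) *
        Real.exp (-(β / 2 * ∑ e : Edge 3 L, frobNorm (flucLink e U - flucLink e V) ^ 2)) := by
  rw [latE_eq_exp_frobSq, sum_edge_frobSq_eq_mean_add_fluc, mul_assoc, ← Real.exp_add]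
  congr 2
  ring

/-- `|sites| = L³`. [folklore] -/
theorem card_site : Fintype.card (Site 3 L) = L ^ 3 := by
  rw [Fintype.card_pi, Finset.prod_const, Finset.card_univ, Fintype.card_fin, ZMod.card]

/-- In `L³β` form: the zero-mode factor is `exp(−(L³β/2) Σ_k ‖m_k(U) − m_k(V)‖_F²)`, the one-site kinetic Gaussian (`linkW_eq_exp_frobSq`) at
the ONE-SITE COUPLING `L³β` of `transferKernel_constLift`. [cite: Luscher1983, §3] -/
theorem latE_eq_mean_mul_fluc' (β : ℝ) (U V : GaugeConfig 3 L SU2) :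
    latE L β U V = Real.exp (2 * β) ^ Fintype.card (Edge 3 L) *
      Real.exp (-((L : ℝ) ^ 3 * β / 2 * ∑ k : Fin 3, frobNorm (meanLink k U - meanLink k V) ^ 2)) *
        Real.exp (-(β / 2 * ∑ e : Edge 3 L, frobNorm (flucLink e U - flucLink e V) ^ 2)) := by
  rw [latE_eq_mean_mul_fluc, card_site]; push_cast; ring_nf

/-! ## §4 Exactness on constant configurations -/

/-- On a constant configuration the direction mean is the one-site link. [folklore] -/
theorem meanLink_constLift (k : Fin 3) (u : GaugeConfig 3 1 SU2) : meanLink k (constLift L u) = (u (0, k) : Matrix (Fin 2) (Fin 2) ℂ) := by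
  unfold meanLink
  simp only [constLift_apply, Finset.sum_const, Finset.card_univ]
  rw [← Nat.cast_smul_eq_nsmul ℂ, smul_smul]
  have hc : (Fintype.card (Site 3 L) : ℂ) ≠ 0 := by exact_mod_cast Fintype.card_ne_zero
  rw [show ((Fintype.card (Site 3 L) : ℝ)⁻¹ : ℂ) = ((Fintype.card (Site 3 L) : ℂ))⁻¹ by push_cast; rfl, inv_mul_cancel₀ hc, one_smul]

/-- On a constant configuration every fluctuation vanishes. [folklore] -/
theorem flucLink_constLift (e : Edge 3 L) (u : GaugeConfig 3 1 SU2) : flucLink e (constLift L u) = 0 := by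
  unfold flucLink
  rw [meanLink_constLift, constLift_apply, sub_self]

end Summit.QuantumFields.YangMills.Theorems.FemtoTransferGap.TwoLattice.Electric

end
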